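import Summits.QuantumFields.YangMills.Theorems.ColdStartUniversalityLatticeLangevinDoeblinBetaZero
import HarnessLib

/-!
# Route `ColdStartUniversality`, crux `NeutralColdStartMixing` (stmt-QuantumFields-27363), stub `stub_langevinLawAbsCont`:
# the law of the `β' = 0` SZZ dynamics at every time `t > 0` is dominated by a multiple of the Haar measure

Helper file (seat `ym-line-csu-p1`, g8).  `map_le_smul_haar_beta_zero`: for every `β' = 0` solution `U` from a deterministic start
`z` on any space and every `t > 0` there is `C` with `law(U_t) ≤ C · Haar^{⊗E}` (in particular `law(U_t) ≪ Haar^{⊗E}`,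
`map_absolutelyContinuous_haar_beta_zero`).  The tree's `map_eq_heatKernel_beta_zero` gives the heat-kernel density only for
`t ≥ 2` (where its positivity `h_t ≥ 1/2` is available); here positivity is bypassed by a SHIFT: with `k` the (continuous, possibly
signed a priori) product heat kernel and `C ≥ sup |k|`, the finite measures `law(U_t) + C·Haar` and `(k + C)·Haar` have the same ridge
moments (`integral_prod_gegenbauer_latitude`, `integral_prod_gegenbauer_mul_prod_heatKernel`), hence coincide
(`measure_eq_of_forall_integral_prod_gegenbauer_eq`), so `law(U_t) ≤ (k + C)·Haar ≤ 2C·Haar`.  No definition, no sorry.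
RECORD-rung R3 plumbing; nothing here bears on the mass gap.
-/

set_option autoImplicit false

noncomputable section

namespace Summit.QuantumFields.YangMills.Theorems.ColdStartUniversality

open MeasureTheory Finset ProbabilityTheory
open scoped BigOperators NNReal ENNReal
open Literature.MathematicalPhysics.QuantumFieldTheory
open Literature.MathematicalPhysics.QuantumFieldTheory.Tomboulis2007 (su2Char)
open Literature.MathematicalPhysics.QuantumLattice (fundamentalRep fundamentalLatticeRep continuous_fundamentalRep)
open Literature.Analysis.SpecialFunctions (gegenbauerSum)
open Literature.Probability.Process

variable {L : ℕ} [NeZero L]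

/-- **The law of the `β' = 0` SZZ dynamics at time `t > 0` is dominated by a multiple of Haar** (any solution from a
deterministic start on any space). [folklore] -/
theorem map_le_smul_haar_beta_zero {t : ℝ≥0} (ht : 0 < (t : ℝ)) (z : GaugeConfig 3 L (Matrix.specialUnitaryGroup (Fin 2) ℂ))
    {Ω : Type} [MeasurableSpace Ω] {P : Measure Ω} [IsProbabilityMeasure P]
    {W : ℝ≥0 → Ω → (Edge 3 L × NoiseIdx 2 → ℝ)} (hW : IsFlatBrownian W P)
    {U : ℝ≥0 → Ω → GaugeConfig 3 L (Matrix.specialUnitaryGroup (Fin 2) ℂ)} (hU0 : ∀ ω, U 0 ω = z)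
    (hU : (latticeLangevinDynamics (fundamentalLatticeRep 2) 0).IsSolution (fundamentalRep (Fin 2)) hW.natFiltration P W U) :
    ∃ C : ℝ, 0 ≤ C ∧ P.map (U t) ≤ (ENNReal.ofReal C) •
      (Measure.pi fun _ : Edge 3 L => haarProbability (Matrix.specialUnitaryGroup (Fin 2) ℂ)) := by
  classical
  haveI := secondCountableTopology_su2
  haveI := borelSpace_config L
  haveI : IsProbabilityMeasure (haarProbability (Matrix.specialUnitaryGroup (Fin 2) ℂ)) := inferInstance
  -- the regular flow realises the same law
  haveI := isProbabilityMeasure_piWiener (Edge 3 L × NoiseIdx 2)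
  have hWc := isFlatBrownian_piWiener 3 L (NoiseIdx 2)
  obtain ⟨Uc, G, hUc, hUm, -, -, -⟩ := exists_regularFlow L 0 hWc
  have hlaw : P.map (U t) = (Measure.pi fun _ : Edge 3 L × NoiseIdx 2 => preWienerMeasure).map (Uc z t) :=
    lawUnique_of_start 0 z hW hWc hU0 hU (fun ω => (hUc z).1 ω) (hUc z).2 t
  rw [hlaw]
  set H : Measure (GaugeConfig 3 L (Matrix.specialUnitaryGroup (Fin 2) ℂ)) :=
    Measure.pi fun _ : Edge 3 L => haarProbability (Matrix.specialUnitaryGroup (Fin 2) ℂ) with hH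
  haveI : IsProbabilityMeasure H := by rw [hH]; infer_instance
  set k : GaugeConfig 3 L (Matrix.specialUnitaryGroup (Fin 2) ℂ) → ℝ := fun y =>
    ∏ e, ∑' n : ℕ, ((n : ℝ) + 1) * Real.exp (-((n : ℝ) * ((n : ℝ) + 2) / 2) * t) * su2Char n (y e * (z e)⁻¹) with hk
  have hk_cont : Continuous k := continuous_prod_heatKernelSU2 ht z
  obtain ⟨C, hC0, hC⟩ := exists_abs_le_of_continuous hk_cont
  have hkC_nonneg : ∀ y, 0 ≤ k y + C := fun y => by linarith [(abs_le.1 (hC y)).1]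
  have hkC_le : ∀ y, k y + C ≤ 2 * C := fun y => by linarith [(abs_le.1 (hC y)).2]
  have hkC_meas : Measurable fun y => ENNReal.ofReal (k y + C) :=
    ENNReal.measurable_ofReal.comp (hk_cont.add continuous_const).measurable
  have hmU : Measurable (Uc z t) := ((hUc z).2.adapted t).mono (hWc.natFiltration.le t) le_rfl
  set lawY : Measure (GaugeConfig 3 L (Matrix.specialUnitaryGroup (Fin 2) ℂ)) :=
    (Measure.pi fun _ : Edge 3 L × NoiseIdx 2 => preWienerMeasure).map (Uc z t) with hlawY
  haveI : IsProbabilityMeasure lawY := Measure.isProbabilityMeasure_map hmU.aemeasurable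
  haveI hfinC : IsFiniteMeasure ((ENNReal.ofReal C) • H) :=
    ⟨by rw [Measure.smul_apply, smul_eq_mul]; exact ENNReal.mul_lt_top ENNReal.ofReal_lt_top (measure_lt_top _ _)⟩
  haveI : IsFiniteMeasure (H.withDensity fun y => ENNReal.ofReal (k y + C)) := by
    refine isFiniteMeasure_withDensity ?_
    have h1 : ∫⁻ y, ENNReal.ofReal (k y + C) ∂H ≤ ∫⁻ _y, ENNReal.ofReal (2 * C) ∂H :=
      lintegral_mono fun y => ENNReal.ofReal_le_ofReal (hkC_le y)
    rw [lintegral_const, measure_univ, mul_one] at h1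
    exact ne_top_of_le_ne_top ENNReal.ofReal_ne_top h1
  -- ### the shifted measures have the same ridge moments
  have heq : lawY + (ENNReal.ofReal C) • H = H.withDensity fun y => ENNReal.ofReal (k y + C) := by
    refine measure_eq_of_forall_integral_prod_gegenbauer_eq (L := L) fun g m => ?_
    have hcontF : Continuous fun y : GaugeConfig 3 L (Matrix.specialUnitaryGroup (Fin 2) ℂ) =>
        ∏ e, gegenbauerSum 1 (m e) (hsForm 2 (fundamentalRep (Fin 2) (g e)) (fundamentalRep (Fin 2) (y e)) / 2) :=
      continuous_prod_gegenbauer_latitude g m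
    obtain ⟨MF, -, hMF⟩ := exists_abs_le_of_continuous hcontF
    have hint : ∀ (ν : Measure (GaugeConfig 3 L (Matrix.specialUnitaryGroup (Fin 2) ℂ))) [IsFiniteMeasure ν],
        Integrable (fun y => ∏ e, gegenbauerSum 1 (m e)
          (hsForm 2 (fundamentalRep (Fin 2) (g e)) (fundamentalRep (Fin 2) (y e)) / 2)) ν := fun ν _ =>
      Integrable.of_bound hcontF.measurable.aestronglyMeasurable MF (Filter.Eventually.of_forall fun y => by
        rw [Real.norm_eq_abs]; exact hMF y)
    obtain ⟨Mk, -, hMk⟩ := exists_abs_le_of_continuous hk_cont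
    have hint_kF : Integrable (fun y => (∏ e, gegenbauerSum 1 (m e)
        (hsForm 2 (fundamentalRep (Fin 2) (g e)) (fundamentalRep (Fin 2) (y e)) / 2)) * k y) H :=
      Integrable.of_bound (hcontF.mul hk_cont).measurable.aestronglyMeasurable (MF * Mk)
        (Filter.Eventually.of_forall fun y => by
          rw [Real.norm_eq_abs, abs_mul]
          exact mul_le_mul (hMF y) (hMk y) (abs_nonneg _) ((abs_nonneg _).trans (hMF y)))
    rw [integral_add_measure (hint lawY) (hint _), integral_smul_measure, ENNReal.toReal_ofReal hC0, smul_eq_mul, hlawY,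
      integral_map hmU.aemeasurable hcontF.aestronglyMeasurable, integral_prod_gegenbauer_latitude hWc Uc hUc hUm z g m t,
      integral_withDensity_eq_integral_toReal_smul hkC_meas (Filter.Eventually.of_forall fun y => ENNReal.ofReal_lt_top)]
    simp_rw [ENNReal.toReal_ofReal (hkC_nonneg _), smul_eq_mul]
    have hsplit : (fun y => (k y + C) * ∏ e, gegenbauerSum 1 (m e)
        (hsForm 2 (fundamentalRep (Fin 2) (g e)) (fundamentalRep (Fin 2) (y e)) / 2)) =
        fun y => (∏ e, gegenbauerSum 1 (m e) (hsForm 2 (fundamentalRep (Fin 2) (g e)) (fundamentalRep (Fin 2) (y e)) / 2)) * k y +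
          C * ∏ e, gegenbauerSum 1 (m e) (hsForm 2 (fundamentalRep (Fin 2) (g e)) (fundamentalRep (Fin 2) (y e)) / 2) := by
      funext y; ring
    rw [hsplit, integral_add hint_kF ((hint H).const_mul C), integral_const_mul, hk, hH,
      integral_prod_gegenbauer_mul_prod_heatKernel ht z g m]
  -- ### conclusion
  refine ⟨2 * C, by positivity, ?_⟩
  calc lawY ≤ lawY + (ENNReal.ofReal C) • H := Measure.le_add_right le_rfl
    _ = H.withDensity fun y => ENNReal.ofReal (k y + C) := heq
    _ ≤ H.withDensity fun _ => ENNReal.ofReal (2 * C) :=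
        withDensity_mono (Filter.Eventually.of_forall fun y => ENNReal.ofReal_le_ofReal (hkC_le y))
    _ = (ENNReal.ofReal (2 * C)) • H := withDensity_const _

/-- **The law of the `β' = 0` SZZ dynamics at time `t > 0` is absolutely continuous with respect to Haar.** [folklore] -/
theorem map_absolutelyContinuous_haar_beta_zero {t : ℝ≥0} (ht : 0 < (t : ℝ))
    (z : GaugeConfig 3 L (Matrix.specialUnitaryGroup (Fin 2) ℂ))
    {Ω : Type} [MeasurableSpace Ω] {P : Measure Ω} [IsProbabilityMeasure P]
    {W : ℝ≥0 → Ω → (Edge 3 L × NoiseIdx 2 → ℝ)} (hW : IsFlatBrownian W P)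
    {U : ℝ≥0 → Ω → GaugeConfig 3 L (Matrix.specialUnitaryGroup (Fin 2) ℂ)} (hU0 : ∀ ω, U 0 ω = z)
    (hU : (latticeLangevinDynamics (fundamentalLatticeRep 2) 0).IsSolution (fundamentalRep (Fin 2)) hW.natFiltration P W U) :
    P.map (U t) ≪ (Measure.pi fun _ : Edge 3 L => haarProbability (Matrix.specialUnitaryGroup (Fin 2) ℂ)) := by
  obtain ⟨C, -, hle⟩ := map_le_smul_haar_beta_zero ht z hW hU0 hU
  exact Measure.absolutelyContinuous_of_le_smul hle

end Summit.QuantumFields.YangMills.Theorems.ColdStartUniversality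

end
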